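import Literature.NumberTheory.EllipticCurves.ManinConstantSemistablePrimewise
import HarnessLib

/-!
# Pasten 2024, Thm. 10.1: `v_p(c_f) ≤ μ_{S,p}` for optimal curves semistable outside `S` — the named fact

Topic `Literature/NumberTheory/EllipticCurves`. ONE named fact (D-0014), no proofs:
`PastenShimura2024_thm_10_1`, VERBATIM the hypothesis binder `h101` of the accepted discharge
`Literature.NumberTheory.Automorphic.PastenShimura2024_cor_10_2_holds_of`
(`Automorphic/ShimuraCurveRibetTakahashiProofs.lean` l. 455, p97414) — librarian sweep g24,
vend-from-binder, promote event 3348182 (the provefact seat of `PastenShimura2024_cor_10_2` may not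
mint it, `lint.fact-fanout`). First consumer: that theorem, whence
`PastenShimura2024_cor_10_2_holds := PastenShimura2024_cor_10_2_holds_of PastenShimura2024_thm_10_1_holds
  mazur_not_dvd_maninConstant_of_odd_holds` the day both inputs are proved; and conversely the tree's
`PastenShimura2024_thm_10_1_of_cor_10_2` returns this statement from the corollary, so modulo Mazur's
Cor. 4.1 the two named facts are equivalent (recorded there).

## Source and reading

H. Pasten, *Shimura curves and the abc conjecture*, J. Number Theory 254 (2024) (arXiv:1705.09251),
Thm. 10.1 (p. 33): "Let `S` be a finite set of primes and let `p` be a prime number. There is a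
constant `μ_{S,p}` depending only on `S` and `p` such that for every optimal elliptic curve `A` over
`ℚ` with semi-stable reduction outside `S` and with associated newform `f ∈ S₂(N)`, we have
`v_p(c_f) ≤ μ_{S,p}`" (proof: Thm. 10.3 and §§10.2–10.6, pp. 33–37). Lattice form over the tree's
vocabulary (`ModularCurve.lean`, `ManinConstantSemistablePrimewise.lean`): for optimal modular
parametrization data `D'` of a globally minimal `W'/ℚ` at level `N'` (optimality = `Λ_{E'} ⊆ c·Λ_f`,
the clause `∀ z ∈ D'.L.lattice, ∃ w ∈ periodLattice D'.f, z = D'.c * w`), semistable outside `S`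
(`N'` squarefree away from `S`), the `p`-adic valuation of the Manin constant `D'.maninConstant` is
bounded by `μ` depending on `S, p` only.

What is deliberately NOT here: the value of `μ_{S,p}`; Cor. 10.2 (the tree's
`PastenShimura2024_cor_10_2`, a separate named fact) and the six proved p. 33 reductions of the seat.
-/

noncomputable section

open scoped MatrixGroups ModularForm

open CongruenceSubgroup UpperHalfPlane

namespace Literature.NumberTheory.EllipticCurves.ModularForms

/-- **Pasten 2024, Thm. 10.1 (lattice form): the `p`-adic valuation of the Manin constant of an
optimal curve semistable outside `S` is bounded in terms of `S` and `p` only.** For every finite set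
of primes `S` and every prime `p` there is `μ : ℕ` such that for every globally minimal elliptic
`W'/ℚ`, every level `N'` and every modular parametrization datum `D'` of `W'` at level `N'` which is
OPTIMAL (`Λ_{E'} ⊆ c · Λ_f`: every `z ∈ D'.L.lattice` is `D'.c * w` with `w ∈ periodLattice D'.f`) and
SEMISTABLE OUTSIDE `S` (`q² ∤ N'` for primes `q ∉ S`), `padicValInt p D'.maninConstant ≤ μ` (p. 33:
"There is a constant `μ_{S,p}` … `v_p(c_f) ≤ μ_{S,p}`"). VERBATIM the binder `h101` of
`Literature.NumberTheory.Automorphic.PastenShimura2024_cor_10_2_holds_of`; users take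
`(h101 : PastenShimura2024_thm_10_1)`. Named fact (D-0014), not proved in the tree.
[cite: PastenShimura2024, Thm. 10.1 p. 33 (proof: Thm. 10.3 and §§10.2–10.6, pp. 33–37)] -/
def PastenShimura2024_thm_10_1 : Prop :=
  ∀ (S : Finset ℕ) (p : ℕ), p.Prime → ∃ μ : ℕ,
    ∀ (W' : WeierstrassCurve ℚ) [W'.IsElliptic] [W'.IsGloballyMinimal] {N' : ℕ} [NeZero N']
      (D' : ModularParametrizationData W' N'),
      (∀ z ∈ D'.L.lattice, ∃ w ∈ periodLattice D'.f, z = D'.c * w) →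
      (∀ q : ℕ, q.Prime → q ∉ S → ¬ q ^ 2 ∣ N') →
      padicValInt p D'.maninConstant ≤ μ

end Literature.NumberTheory.EllipticCurves.ModularForms

end
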